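import Summits.BirchSwinnertonDyer.Rank1Residual.P2.KrizLiMordellBasesMembership
import Mathlib.Tactic.NormNum.LegendreSymbol
import HarnessLib

/-!
# Cell `bsd-print-cf2` (D-0131 (2) PRINT TIER, leaf CornerF @ `p = 2`), typer ty2 — EXPLICIT MEMBERS of
# the Kriz–Li families of the (★)-certified bases ADDITIVE at `2`: `972d1`, `3888s1`, `1728a1`, `1728v1`
# over `ℚ(√−23)`, `d = 13` decided in the kernel, and `BSD(W′, 2)` BY NAME on their isogeny classes

HONEST FRAMING. End-to-end check of the DISCHARGE INTERFACE (ty2) at one explicit twist per base, for the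
four (★)-certified `j = 0` bases with ADDITIVE reduction at `2` (`y² = x³ + k`, `k = 36, 48, 2, −2`; Kodaira
`IV*, II*, II, II`; `c₂` odd by Tate's algorithm in the tree, `P2/KrizLiMordellAtTwo.lean`): the index set
`𝒩(E, ℚ(√−23))` of Kriz–Li Def 4.1 is DECIDED in the kernel (`inN_curveX_of_explicit`, p566908: `d ≡ 1 (mod 4)`
square-free, every prime `ℓ ∣ d` outside `2N = 2^a·3^b`, split in `K`, `a_ℓ(E)` odd ⟺ an even number of
cube roots of `−k` in `𝔽_ℓ`) at the least admissible prime `d = 13` (`(−23/13) = 1`; `−36, −48, ∓2` are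
non-cubes mod `13`; `13 ≡ 1 (mod 12)` so `χ₁₃(−N) = +1` by the settings' sign clause, `N = 3ᵏ·2^{f₂}`,
`f₂` even), and then every globally minimal `W′` `ℚ`-isogenous to `E^{(13)}` or to `E^{(−299)}` satisfies
`BSD(W′, 2)` from prover p3's generic door `bsdp_two_of_isIsogenousToKrizLiTwistOfSmallCMBase` granted
BY NAME the seven facts `hKL h33 hS31 hBF hmod hGZK hCassels` (conjuncts of `𝔅_inert` + asides
20767/20768) and the DISPLAYED (★)-datum `hSD : HasKrizLiStarDatum curveX (sqrtField (−23))` — which for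
a base ADDITIVE at `2` INCLUDES Kriz–Li's Manin clause "`Dt.c` odd" for the displayed parametrisation; a
CERTIFICATE (cell dossier §14.4/§14.8), NOT print; currency LITERAL-by-name((★)-display). Also the
analytic ranks `1 / 0` of each pair (Kriz–Li Thm 4.3 by name). The field is the tree's model
`sqrtField (−23)` (`d_K = −23`, p3's `KrizLiTwoFortyThreeCurve`). Pattern = p3's printed member
`bsdp_two_twist_thirteen_curve243a1`. No named fact; nothing asserted; the leaf is OPEN AS A CLASS;
beyond print: NO.

References: [KrizLi2019] Thm 5.1 (2) = arXiv:1606.03172 Thm 1.12, Thm 4.3, Def 4.1, §6 Ex. 6.2, Rem. 6.3;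
[Cremona1997] Table 1 (972d1, 1728a1, 1728v1, 3888s1); cell dossier §14.4, §14.8 (certified pairs).
-/

noncomputable section

open scoped Classical

open WeierstrassCurve NumberField Literature.NumberTheory.EllipticCurves
  Literature.NumberTheory.EllipticCurves.Rank1Residual
  Literature.NumberTheory.EllipticCurves.ModularForms
  Summit.BirchSwinnertonDyer.Rank1Residual

set_option autoImplicit false

namespace Summit.BirchSwinnertonDyer.Rank1Residual.P2

/-! ### `972d1` (`y² = x³ + 36`, Kodaira `IV*` at `2`) over `ℚ(√−23)`: `d = 13` -/

/-- **`13 ∈ 𝒩(972d1, ℚ(√−23))`**, decided in the kernel: `13` is prime, `≡ 1 (mod 4)`, `∉ {2, 3}`,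
`(−23/13) = 1`, and `x³ = -36` has NO root in `𝔽₁₃` (so `a₁₃(972d1)` is odd).
[cite: KrizLi2019, Def. 4.1 (FMS) = arXiv Def. 3.1] -/
theorem inN_thirteen_curve972d1 : KrizLi2019.InN curve972d1 (sqrtField (-23)) 13 :=
  inN_curve972d1_of_explicit (sqrtField.finrank_eq_two (-23)) (d := 13) (by norm_num)
    (by exact (Nat.prime_iff.1 (by norm_num)).squarefree)
    (fun ℓ hℓ hℓd => by
      have h : ℓ ∣ 13 := by simpa using hℓd
      obtain rfl := (Nat.prime_dvd_prime_iff_eq hℓ (by norm_num)).mp h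
      have key : Even ((Finset.univ.filter fun x : ZMod 13 => x ^ 3 = -36).card) := by decide
      rw [isImaginaryQuadratic_and_discr_sqrtField_neg_twentyThree.2]
      exact ⟨by norm_num, by norm_num, by norm_num, key⟩)

/-- **`BSD(W′, 2)` for every globally minimal `W′` `ℚ`-isogenous to `972d1^{(13)}` or to `972d1^{(−299)}`**,
granted BY NAME the seven facts and the DISPLAYED (★)-datum of `(972d1, ℚ(√−23))` (INCLUDING the Manin
clause, the base being additive at `2`); the membership `13 ∈ 𝒩`, the sign `χ₁₃(−N) = 1`, `c₂` odd and every
other Kriz–Li hypothesis of the base decided or proved in the kernel.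
[cite: KrizLi2019, Thm. 5.1 (2), Def. 4.1, §6 Ex. 6.2] [cite: CreutzMiller2012, Thm. 1.1]
[cite: BurungaleFlach2024, Thm. 1.1 and Cor. 2] [cite: MilneADT2006, Thm. I.7.3] -/
theorem bsdp_two_twist_thirteen_curve972d1 (hKL : KrizLi2019.thm112_bsdTwo_twist)
    (h33 : KrizLi2019.thm33_rank_twist) (hS31 : bsdTriple_of_analyticRank_le_one_of_conductor_lt)
    (hBF : bsdTriple_of_hasCM_of_L_one_ne_zero) (hmod : hasEntireLFunction_rat)
    (hGZK : rank_eq_analyticRank_of_analyticRank_le_one) (hCassels : bsdRHS_eq_of_isIsogenous)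
    (hSD : HasKrizLiStarDatum curve972d1 (sqrtField (-23)))
    (W' : WeierstrassCurve ℚ) [W'.IsElliptic] [W'.IsGloballyMinimal]
    (hiso : IsIsogenous W' (curve972d1.quadraticTwist ((13 : ℤ) : ℚ)) ∨
      IsIsogenous W' (curve972d1.quadraticTwist ((-23 * 13 : ℤ) : ℚ))) : BSDp W' 2 :=
  bsdp_two_of_isIsogenousToKrizLiTwistOfSmallCMBase hKL h33 hS31 hBF hmod hGZK hCassels W'
    (isIsogenousToKrizLiTwistOfSmallCMBase_of_curve972d1_of_discr_eq
      isImaginaryQuadratic_and_discr_sqrtField_neg_twentyThree.1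
      isImaginaryQuadratic_and_discr_sqrtField_neg_twentyThree.2 hSD inN_thirteen_curve972d1
      (by norm_num) (by norm_num) hiso)

/-- **The analytic ranks of the two explicit twists**: `r_an = 1` on every globally minimal `ℚ`-model of
`972d1^{(13)}` and `r_an = 0` on every one of `972d1^{(−299)}`, granted BY NAME Kriz–Li Thm 4.3, the CM
converse fact `hBF`, modularity and the DISPLAYED (★)-datum. [cite: KrizLi2019, Thm. 4.3 (FMS) = arXiv Thm. 3.3] -/
theorem analyticRank_twist_thirteen_curve972d1 (h33 : KrizLi2019.thm33_rank_twist)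
    (hBF : bsdTriple_of_hasCM_of_L_one_ne_zero) (hmod : hasEntireLFunction_rat)
    (hSD : HasKrizLiStarDatum curve972d1 (sqrtField (-23)))
    (W₁ W₂ : WeierstrassCurve ℚ) [W₁.IsElliptic] [W₁.IsGloballyMinimal] [W₂.IsElliptic] [W₂.IsGloballyMinimal]
    (hW₁ : ∃ C : VariableChange ℚ, C • curve972d1.quadraticTwist ((13 : ℤ) : ℚ) = W₁)
    (hW₂ : ∃ C : VariableChange ℚ, C • curve972d1.quadraticTwist ((-23 * 13 : ℤ) : ℚ) = W₂) :
    W₁.analyticRank = 1 ∧ W₂.analyticRank = 0 := by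
  have hK := isImaginaryQuadratic_and_discr_sqrtField_neg_twentyThree
  have e : ((13 * NumberField.discr (sqrtField (-23)) : ℤ) : ℚ) = ((-23 * 13 : ℤ) : ℚ) := by
    rw [hK.2]; norm_num
  exact analyticRank_of_twist_of_hasKrizLiStarDatum curve972d1 h33 hBF hmod hasCM_curve972d1
    one_le_mordellWeilRank_curve972d1 twoTorsion_curve972d1 (sqrtField (-23)) hK.1
    (satisfiesHeegnerHypothesis_curve972d1_of_discr_eq (sqrtField.finrank_eq_two (-23)) hK.2) hSD
    inN_thirteen_curve972d1 (sign_mul_jacobiSym_conductorNorm_curve972d1 (by norm_num) (by norm_num))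
    W₁ W₂ hW₁ (by rw [e]; exact hW₂)

/-! ### `3888s1` (`y² = x³ + 48`, Kodaira `II*` at `2`) over `ℚ(√−23)`: `d = 13` -/

/-- **`13 ∈ 𝒩(3888s1, ℚ(√−23))`**, decided in the kernel: `13` is prime, `≡ 1 (mod 4)`, `∉ {2, 3}`,
`(−23/13) = 1`, and `x³ = -48` has NO root in `𝔽₁₃` (so `a₁₃(3888s1)` is odd).
[cite: KrizLi2019, Def. 4.1 (FMS) = arXiv Def. 3.1] -/
theorem inN_thirteen_curve3888s1 : KrizLi2019.InN curve3888s1 (sqrtField (-23)) 13 :=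
  inN_curve3888s1_of_explicit (sqrtField.finrank_eq_two (-23)) (d := 13) (by norm_num)
    (by exact (Nat.prime_iff.1 (by norm_num)).squarefree)
    (fun ℓ hℓ hℓd => by
      have h : ℓ ∣ 13 := by simpa using hℓd
      obtain rfl := (Nat.prime_dvd_prime_iff_eq hℓ (by norm_num)).mp h
      have key : Even ((Finset.univ.filter fun x : ZMod 13 => x ^ 3 = -48).card) := by decide
      rw [isImaginaryQuadratic_and_discr_sqrtField_neg_twentyThree.2]
      exact ⟨by norm_num, by norm_num, by norm_num, key⟩)

/-- **`BSD(W′, 2)` for every globally minimal `W′` `ℚ`-isogenous to `3888s1^{(13)}` or to `3888s1^{(−299)}`**,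
granted BY NAME the seven facts and the DISPLAYED (★)-datum of `(3888s1, ℚ(√−23))` (INCLUDING the Manin
clause, the base being additive at `2`); the membership `13 ∈ 𝒩`, the sign `χ₁₃(−N) = 1`, `c₂` odd and every
other Kriz–Li hypothesis of the base decided or proved in the kernel.
[cite: KrizLi2019, Thm. 5.1 (2), Def. 4.1, §6 Ex. 6.2] [cite: CreutzMiller2012, Thm. 1.1]
[cite: BurungaleFlach2024, Thm. 1.1 and Cor. 2] [cite: MilneADT2006, Thm. I.7.3] -/
theorem bsdp_two_twist_thirteen_curve3888s1 (hKL : KrizLi2019.thm112_bsdTwo_twist)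
    (h33 : KrizLi2019.thm33_rank_twist) (hS31 : bsdTriple_of_analyticRank_le_one_of_conductor_lt)
    (hBF : bsdTriple_of_hasCM_of_L_one_ne_zero) (hmod : hasEntireLFunction_rat)
    (hGZK : rank_eq_analyticRank_of_analyticRank_le_one) (hCassels : bsdRHS_eq_of_isIsogenous)
    (hSD : HasKrizLiStarDatum curve3888s1 (sqrtField (-23)))
    (W' : WeierstrassCurve ℚ) [W'.IsElliptic] [W'.IsGloballyMinimal]
    (hiso : IsIsogenous W' (curve3888s1.quadraticTwist ((13 : ℤ) : ℚ)) ∨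
      IsIsogenous W' (curve3888s1.quadraticTwist ((-23 * 13 : ℤ) : ℚ))) : BSDp W' 2 :=
  bsdp_two_of_isIsogenousToKrizLiTwistOfSmallCMBase hKL h33 hS31 hBF hmod hGZK hCassels W'
    (isIsogenousToKrizLiTwistOfSmallCMBase_of_curve3888s1_of_discr_eq
      isImaginaryQuadratic_and_discr_sqrtField_neg_twentyThree.1
      isImaginaryQuadratic_and_discr_sqrtField_neg_twentyThree.2 hSD inN_thirteen_curve3888s1
      (by norm_num) (by norm_num) hiso)

/-- **The analytic ranks of the two explicit twists**: `r_an = 1` on every globally minimal `ℚ`-model of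
`3888s1^{(13)}` and `r_an = 0` on every one of `3888s1^{(−299)}`, granted BY NAME Kriz–Li Thm 4.3, the CM
converse fact `hBF`, modularity and the DISPLAYED (★)-datum. [cite: KrizLi2019, Thm. 4.3 (FMS) = arXiv Thm. 3.3] -/
theorem analyticRank_twist_thirteen_curve3888s1 (h33 : KrizLi2019.thm33_rank_twist)
    (hBF : bsdTriple_of_hasCM_of_L_one_ne_zero) (hmod : hasEntireLFunction_rat)
    (hSD : HasKrizLiStarDatum curve3888s1 (sqrtField (-23)))
    (W₁ W₂ : WeierstrassCurve ℚ) [W₁.IsElliptic] [W₁.IsGloballyMinimal] [W₂.IsElliptic] [W₂.IsGloballyMinimal]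
    (hW₁ : ∃ C : VariableChange ℚ, C • curve3888s1.quadraticTwist ((13 : ℤ) : ℚ) = W₁)
    (hW₂ : ∃ C : VariableChange ℚ, C • curve3888s1.quadraticTwist ((-23 * 13 : ℤ) : ℚ) = W₂) :
    W₁.analyticRank = 1 ∧ W₂.analyticRank = 0 := by
  have hK := isImaginaryQuadratic_and_discr_sqrtField_neg_twentyThree
  have e : ((13 * NumberField.discr (sqrtField (-23)) : ℤ) : ℚ) = ((-23 * 13 : ℤ) : ℚ) := by
    rw [hK.2]; norm_num
  exact analyticRank_of_twist_of_hasKrizLiStarDatum curve3888s1 h33 hBF hmod hasCM_curve3888s1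
    one_le_mordellWeilRank_curve3888s1 twoTorsion_curve3888s1 (sqrtField (-23)) hK.1
    (satisfiesHeegnerHypothesis_curve3888s1_of_discr_eq (sqrtField.finrank_eq_two (-23)) hK.2) hSD
    inN_thirteen_curve3888s1 (sign_mul_jacobiSym_conductorNorm_curve3888s1 (by norm_num) (by norm_num))
    W₁ W₂ hW₁ (by rw [e]; exact hW₂)

/-! ### `1728a1` (`y² = x³ + 2`, Kodaira `II` at `2`) over `ℚ(√−23)`: `d = 13` -/

/-- **`13 ∈ 𝒩(1728a1, ℚ(√−23))`**, decided in the kernel: `13` is prime, `≡ 1 (mod 4)`, `∉ {2, 3}`,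
`(−23/13) = 1`, and `x³ = -2` has NO root in `𝔽₁₃` (so `a₁₃(1728a1)` is odd).
[cite: KrizLi2019, Def. 4.1 (FMS) = arXiv Def. 3.1] -/
theorem inN_thirteen_curve1728a1 : KrizLi2019.InN curve1728a1 (sqrtField (-23)) 13 :=
  inN_curve1728a1_of_explicit (sqrtField.finrank_eq_two (-23)) (d := 13) (by norm_num)
    (by exact (Nat.prime_iff.1 (by norm_num)).squarefree)
    (fun ℓ hℓ hℓd => by
      have h : ℓ ∣ 13 := by simpa using hℓd
      obtain rfl := (Nat.prime_dvd_prime_iff_eq hℓ (by norm_num)).mp h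
      have key : Even ((Finset.univ.filter fun x : ZMod 13 => x ^ 3 = -2).card) := by decide
      rw [isImaginaryQuadratic_and_discr_sqrtField_neg_twentyThree.2]
      exact ⟨by norm_num, by norm_num, by norm_num, key⟩)

/-- **`BSD(W′, 2)` for every globally minimal `W′` `ℚ`-isogenous to `1728a1^{(13)}` or to `1728a1^{(−299)}`**,
granted BY NAME the seven facts and the DISPLAYED (★)-datum of `(1728a1, ℚ(√−23))` (INCLUDING the Manin
clause, the base being additive at `2`); the membership `13 ∈ 𝒩`, the sign `χ₁₃(−N) = 1`, `c₂` odd and every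
other Kriz–Li hypothesis of the base decided or proved in the kernel.
[cite: KrizLi2019, Thm. 5.1 (2), Def. 4.1, §6 Ex. 6.2] [cite: CreutzMiller2012, Thm. 1.1]
[cite: BurungaleFlach2024, Thm. 1.1 and Cor. 2] [cite: MilneADT2006, Thm. I.7.3] -/
theorem bsdp_two_twist_thirteen_curve1728a1 (hKL : KrizLi2019.thm112_bsdTwo_twist)
    (h33 : KrizLi2019.thm33_rank_twist) (hS31 : bsdTriple_of_analyticRank_le_one_of_conductor_lt)
    (hBF : bsdTriple_of_hasCM_of_L_one_ne_zero) (hmod : hasEntireLFunction_rat)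
    (hGZK : rank_eq_analyticRank_of_analyticRank_le_one) (hCassels : bsdRHS_eq_of_isIsogenous)
    (hSD : HasKrizLiStarDatum curve1728a1 (sqrtField (-23)))
    (W' : WeierstrassCurve ℚ) [W'.IsElliptic] [W'.IsGloballyMinimal]
    (hiso : IsIsogenous W' (curve1728a1.quadraticTwist ((13 : ℤ) : ℚ)) ∨
      IsIsogenous W' (curve1728a1.quadraticTwist ((-23 * 13 : ℤ) : ℚ))) : BSDp W' 2 :=
  bsdp_two_of_isIsogenousToKrizLiTwistOfSmallCMBase hKL h33 hS31 hBF hmod hGZK hCassels W'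
    (isIsogenousToKrizLiTwistOfSmallCMBase_of_curve1728a1_of_discr_eq
      isImaginaryQuadratic_and_discr_sqrtField_neg_twentyThree.1
      isImaginaryQuadratic_and_discr_sqrtField_neg_twentyThree.2 hSD inN_thirteen_curve1728a1
      (by norm_num) (by norm_num) hiso)

/-- **The analytic ranks of the two explicit twists**: `r_an = 1` on every globally minimal `ℚ`-model of
`1728a1^{(13)}` and `r_an = 0` on every one of `1728a1^{(−299)}`, granted BY NAME Kriz–Li Thm 4.3, the CM
converse fact `hBF`, modularity and the DISPLAYED (★)-datum. [cite: KrizLi2019, Thm. 4.3 (FMS) = arXiv Thm. 3.3] -/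
theorem analyticRank_twist_thirteen_curve1728a1 (h33 : KrizLi2019.thm33_rank_twist)
    (hBF : bsdTriple_of_hasCM_of_L_one_ne_zero) (hmod : hasEntireLFunction_rat)
    (hSD : HasKrizLiStarDatum curve1728a1 (sqrtField (-23)))
    (W₁ W₂ : WeierstrassCurve ℚ) [W₁.IsElliptic] [W₁.IsGloballyMinimal] [W₂.IsElliptic] [W₂.IsGloballyMinimal]
    (hW₁ : ∃ C : VariableChange ℚ, C • curve1728a1.quadraticTwist ((13 : ℤ) : ℚ) = W₁)
    (hW₂ : ∃ C : VariableChange ℚ, C • curve1728a1.quadraticTwist ((-23 * 13 : ℤ) : ℚ) = W₂) :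
    W₁.analyticRank = 1 ∧ W₂.analyticRank = 0 := by
  have hK := isImaginaryQuadratic_and_discr_sqrtField_neg_twentyThree
  have e : ((13 * NumberField.discr (sqrtField (-23)) : ℤ) : ℚ) = ((-23 * 13 : ℤ) : ℚ) := by
    rw [hK.2]; norm_num
  exact analyticRank_of_twist_of_hasKrizLiStarDatum curve1728a1 h33 hBF hmod hasCM_curve1728a1
    one_le_mordellWeilRank_curve1728a1 twoTorsion_curve1728a1 (sqrtField (-23)) hK.1
    (satisfiesHeegnerHypothesis_curve1728a1_of_discr_eq (sqrtField.finrank_eq_two (-23)) hK.2) hSD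
    inN_thirteen_curve1728a1 (sign_mul_jacobiSym_conductorNorm_curve1728a1 (by norm_num) (by norm_num))
    W₁ W₂ hW₁ (by rw [e]; exact hW₂)

/-! ### `1728v1` (`y² = x³ + −2`, Kodaira `II` at `2`) over `ℚ(√−23)`: `d = 13` -/

/-- **`13 ∈ 𝒩(1728v1, ℚ(√−23))`**, decided in the kernel: `13` is prime, `≡ 1 (mod 4)`, `∉ {2, 3}`,
`(−23/13) = 1`, and `x³ = 2` has NO root in `𝔽₁₃` (so `a₁₃(1728v1)` is odd).
[cite: KrizLi2019, Def. 4.1 (FMS) = arXiv Def. 3.1] -/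
theorem inN_thirteen_curve1728v1 : KrizLi2019.InN curve1728v1 (sqrtField (-23)) 13 :=
  inN_curve1728v1_of_explicit (sqrtField.finrank_eq_two (-23)) (d := 13) (by norm_num)
    (by exact (Nat.prime_iff.1 (by norm_num)).squarefree)
    (fun ℓ hℓ hℓd => by
      have h : ℓ ∣ 13 := by simpa using hℓd
      obtain rfl := (Nat.prime_dvd_prime_iff_eq hℓ (by norm_num)).mp h
      have key : Even ((Finset.univ.filter fun x : ZMod 13 => x ^ 3 = 2).card) := by decide
      rw [isImaginaryQuadratic_and_discr_sqrtField_neg_twentyThree.2]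
      exact ⟨by norm_num, by norm_num, by norm_num, key⟩)

/-- **`BSD(W′, 2)` for every globally minimal `W′` `ℚ`-isogenous to `1728v1^{(13)}` or to `1728v1^{(−299)}`**,
granted BY NAME the seven facts and the DISPLAYED (★)-datum of `(1728v1, ℚ(√−23))` (INCLUDING the Manin
clause, the base being additive at `2`); the membership `13 ∈ 𝒩`, the sign `χ₁₃(−N) = 1`, `c₂` odd and every
other Kriz–Li hypothesis of the base decided or proved in the kernel.
[cite: KrizLi2019, Thm. 5.1 (2), Def. 4.1, §6 Ex. 6.2] [cite: CreutzMiller2012, Thm. 1.1]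
[cite: BurungaleFlach2024, Thm. 1.1 and Cor. 2] [cite: MilneADT2006, Thm. I.7.3] -/
theorem bsdp_two_twist_thirteen_curve1728v1 (hKL : KrizLi2019.thm112_bsdTwo_twist)
    (h33 : KrizLi2019.thm33_rank_twist) (hS31 : bsdTriple_of_analyticRank_le_one_of_conductor_lt)
    (hBF : bsdTriple_of_hasCM_of_L_one_ne_zero) (hmod : hasEntireLFunction_rat)
    (hGZK : rank_eq_analyticRank_of_analyticRank_le_one) (hCassels : bsdRHS_eq_of_isIsogenous)
    (hSD : HasKrizLiStarDatum curve1728v1 (sqrtField (-23)))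
    (W' : WeierstrassCurve ℚ) [W'.IsElliptic] [W'.IsGloballyMinimal]
    (hiso : IsIsogenous W' (curve1728v1.quadraticTwist ((13 : ℤ) : ℚ)) ∨
      IsIsogenous W' (curve1728v1.quadraticTwist ((-23 * 13 : ℤ) : ℚ))) : BSDp W' 2 :=
  bsdp_two_of_isIsogenousToKrizLiTwistOfSmallCMBase hKL h33 hS31 hBF hmod hGZK hCassels W'
    (isIsogenousToKrizLiTwistOfSmallCMBase_of_curve1728v1_of_discr_eq
      isImaginaryQuadratic_and_discr_sqrtField_neg_twentyThree.1
      isImaginaryQuadratic_and_discr_sqrtField_neg_twentyThree.2 hSD inN_thirteen_curve1728v1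
      (by norm_num) (by norm_num) hiso)

/-- **The analytic ranks of the two explicit twists**: `r_an = 1` on every globally minimal `ℚ`-model of
`1728v1^{(13)}` and `r_an = 0` on every one of `1728v1^{(−299)}`, granted BY NAME Kriz–Li Thm 4.3, the CM
converse fact `hBF`, modularity and the DISPLAYED (★)-datum. [cite: KrizLi2019, Thm. 4.3 (FMS) = arXiv Thm. 3.3] -/
theorem analyticRank_twist_thirteen_curve1728v1 (h33 : KrizLi2019.thm33_rank_twist)
    (hBF : bsdTriple_of_hasCM_of_L_one_ne_zero) (hmod : hasEntireLFunction_rat)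
    (hSD : HasKrizLiStarDatum curve1728v1 (sqrtField (-23)))
    (W₁ W₂ : WeierstrassCurve ℚ) [W₁.IsElliptic] [W₁.IsGloballyMinimal] [W₂.IsElliptic] [W₂.IsGloballyMinimal]
    (hW₁ : ∃ C : VariableChange ℚ, C • curve1728v1.quadraticTwist ((13 : ℤ) : ℚ) = W₁)
    (hW₂ : ∃ C : VariableChange ℚ, C • curve1728v1.quadraticTwist ((-23 * 13 : ℤ) : ℚ) = W₂) :
    W₁.analyticRank = 1 ∧ W₂.analyticRank = 0 := by
  have hK := isImaginaryQuadratic_and_discr_sqrtField_neg_twentyThree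
  have e : ((13 * NumberField.discr (sqrtField (-23)) : ℤ) : ℚ) = ((-23 * 13 : ℤ) : ℚ) := by
    rw [hK.2]; norm_num
  exact analyticRank_of_twist_of_hasKrizLiStarDatum curve1728v1 h33 hBF hmod hasCM_curve1728v1
    one_le_mordellWeilRank_curve1728v1 twoTorsion_curve1728v1 (sqrtField (-23)) hK.1
    (satisfiesHeegnerHypothesis_curve1728v1_of_discr_eq (sqrtField.finrank_eq_two (-23)) hK.2) hSD
    inN_thirteen_curve1728v1 (sign_mul_jacobiSym_conductorNorm_curve1728v1 (by norm_num) (by norm_num))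
    W₁ W₂ hW₁ (by rw [e]; exact hW₂)

end Summit.BirchSwinnertonDyer.Rank1Residual.P2

end
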